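import Literature.NumberTheory.EllipticCurves.MurtySinhaEquidistributionOfTraceFormula
import Mathlib.Analysis.SpecialFunctions.Arcosh
import HarnessLib

/-!
# Murty–Sinha's effective equidistribution theorem (Thm. 2, weight `2`) from the Eichler–Selberg
# trace formula ALONE (no Ramanujan–Petersson / Deligne input)

Sibling file of `Literature.NumberTheory.EllipticCurves.MurtySinhaEquidistribution` (the named fact
`murtySinha2009_thm2_weightTwo`: M. R. Murty, K. Sinha, *Effective equidistribution of eigenvalues
of Hecke operators*, J. Number Theory **129** (2009) 681–714 [MurtySinha2009], **Theorem 2**, p. 682,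
weight `2`) and of `MurtySinhaEquidistributionOfTraceFormula`, which proves that fact from the TWO
external inputs of the printed proof: the Eichler–Selberg trace formula
(`Literature.NumberTheory.Automorphic.HeckeTraceFormulaGL2Level N 1 2`, Schoof–van der Vlugt Thm. 2.2
= loc. cit. Thm. 10) and Deligne's bound `|a_{p,i}| ≤ 2√p`
(`Deligne1974_heckeT_eigenvalue_norm_le`; loc. cit. §1, p. 681: "By a result of Deligne [7], we know
that the eigenvalues of `T_p` lie in the interval `[-2p^{(k-1)/2}, 2p^{(k-1)/2}]`", which is what lets
the printed proof write `a_{p,i}/p^{(k-1)/2} = 2cos θ_i`, §10 p. 700).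

**This file removes the second input**:
`murtySinha2009_thm2_weightTwo_of_traceFormula_only :
(∀ N, HeckeTraceFormulaGL2Level N 1 2) → murtySinha2009_thm2_weightTwo`
(and the sharper `murtySinha2009_thm2_weightTwo_of_primePowTraces_only`, from the identities
`Tr(T_{p^c} | S₂(Γ₀(N))) = A₁ + A₂ + A₃ + A₄` at the level `N` and the prime `p ∤ N` at hand only).
So the only undischarged input behind Murty–Sinha's Theorem 2 in the tree is the trace formula.

## The argument (a variant of loc. cit. §10, not in the source)

Let `x_i = a_{p,i}/√p ∈ ℝ` (`T_p` is self-adjoint for the Petersson product, `heckeT_selfAdjoint_holds`,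
so the spectrum is real; nothing is assumed about its size) and let `X_c = U_c(·/2)` be the Chebyshev
polynomials of `MurtySinhaMultiplicityProofs` (`chebX`). The trace formula gives the moments
`|Σ_i X_c(x_i) - r γ_c| ≤ E_c` for ALL `c` (`γ_c = p^{-c/2}` for even `c`, `0` for odd `c`;
`MurtySinhaMultiplicityHeckeProofs`, `MurtySinhaMultiplicityGeometricProofs`). Call `x_i`
*exceptional* if `|x_i| > 2`, write `|x_i| = 2cosh t_i` (`t_i > 0`), and CLAMP it to `±2`, i.e. use the
angles `θ_i = arccos(x_i/2) ∈ [0, π]` (Mathlib's `arccos` is constant outside `[-1, 1]`). With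
`n = 2M + 3` and `G_i = X_n(x_i)/(n+1)`:

1. `Σ_i X_n(x_i)² ≤ 2r + (n+1)E` by the linearisation `X_n² = Σ_{j ≤ n} X_{2j}` (`chebX_mul_chebX`)
   and `Σ_j p^{-j} ≤ 2` (`sum_chebX_sq_le`);
2. an exceptional point has `G_i² ≥ 1` (`X_n(2cosh t) ≥ n + 1`), so
   `#{exceptional} ≤ Σ_i G_i² ≤ (2r + (n+1)E)/(n+1)²` (`card_filter_two_lt_abs_le`);
3. for `1 ≤ d ≤ M` the `d`-th cosine Weyl sum of the clamped angles differs from the moment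
   combination `Σ_i (X_d - X_{d-2})(x_i)` exactly by `Σ_{exc} ±(2cosh(d t_i) - 2)`, and
   `2cosh(d t_i) - 2 ≤ 2cosh(M t_i) - 2 ≤ 2(G_i² - 1)` because
   `X_n(2cosh t) - (n+1) = Σ_{0<k≤n, k≡n (2)} 2(cosh(kt) - 1) ≥ (n - M - 1)(cosh(Mt) - 1) ≥ ((n+1)/2)(cosh(Mt) - 1)`
   (`mul_cosh_sub_one_le_chebX`, `two_mul_cosh_sub_two_le`, `abs_weylTerm_sub_le`); hence the Weyl
   sums are within `W = 2E + 2(2r + (n+1)E)/(n+1)²` (`abs_weyl_cos_clamped_le`);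
4. the Erdős–Turán inequality (`Literature.Analysis.Fourier.abs_ceilCount_sub_integral_le`, Thm. 8
   of the source) for the symmetrised clamped angles `±θ_i` against `g_p`
   (`abs_card_filter_Icc_sub_integral_le_of_weyl`, the circle-side half of
   `abs_card_Icc_sub_integral_le` with the Weyl bound kept abstract), plus at most `#{exceptional}`
   mis-counted clamped points, gives
   `|#{i : x_i ∈ [a, b]} - r ∫ 2g_p| ≤ 290 r/(M+1) + 5(M+1)E` for `[a, b] ⊆ [-2, 2]`
   (`abs_card_Icc_sub_integral_le_of_moments`) — the same shape as Thm. 19, with moments up to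
   `2(2M+3)` instead of `M`;
5. the bookkeeping of §10 (`MurtySinha.real_bookkeeping`, `M = [c log 2N / log p]`) is applied to
   `(37/1160)·|count - r∫dμ_p|` at the shifted parameter `⌊(M-3)/2⌋`; the absolute constant becomes
   `(1160/37)·A₂₃`.

By-product of step 2 (not stated separately): from the trace formula alone, all but
`O(r (log p/log N)²)` of the eigenvalues of `T_p` on `S₂(Γ₀(N))` satisfy the Ramanujan bound
`|a_{p,i}| ≤ 2√p`.

## Main results

* `MurtySinha.abs_card_Icc_sub_integral_le_of_moments` — interval counts from Chebyshev moments for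
  an ARBITRARY finite real family (no `|x_i| ≤ 2` hypothesis).
* `MurtySinha.count_sub_integral_le_of_primePowTraces_only` — Thm. 19 for `T_p` on `S₂(Γ₀(N))` from
  the trace identities at the powers of `p` only.
* `murtySinha2009_thm2_weightTwo_of_primePowTraces_only`,
  `murtySinha2009_thm2_weightTwo_of_traceFormula_only` — Theorem 2 (the named fact) from the trace
  formula alone. (Eq. (1), `murtySinha2009_eigenvalue_multiplicity_weightTwo`, then also follows
  through Theorem 2 as `murtySinha2009_eigenvalue_multiplicity_weightTwo_of_thm2
  (murtySinha2009_thm2_weightTwo_of_traceFormula_only hTF)`; the tree's statement of that implication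
  is `murtySinha2009_eigenvalue_multiplicity_weightTwo_of_traceFormula` in
  `MurtySinhaMultiplicityOfTraceFormula`, not restated here.)

## References

* [MurtySinha2009] Thm. 2 (p. 682), §1 (p. 681), p. 684, Thm. 8 (p. 686), §§7–10 (pp. 691–701),
  Thm. 19 (p. 701). Held: `paper:doi-10-1016-j-jnt-2008-10-010` (pp. 681–684, 700–701 read).
* [SchoofVandervlugt1991] Thm. 2.2 (the trace formula, the remaining input).
-/

noncomputable section

open scoped MatrixGroups ModularForm ComplexConjugate

open Real Finset MeasureTheory intervalIntegral
open CongruenceSubgroup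
open Literature.Analysis.Fourier (abs_ceilCount_sub_integral_le)

namespace Literature.NumberTheory.EllipticCurves.ModularForms

namespace MurtySinha

/-! ### Chebyshev polynomials off `[-2, 2]`: hyperbolic parametrisation -/

/-- Parity: `X_n(-x) = (-1)^n X_n(x)`. [folklore] -/
theorem chebX_neg (n : ℕ) (x : ℝ) : chebX n (-x) = (-1) ^ n * chebX n x := by
  have key : ∀ n : ℕ, chebX n (-x) = (-1) ^ n * chebX n x ∧
      chebX (n + 1) (-x) = (-1) ^ (n + 1) * chebX (n + 1) x := by
    intro n
    induction n with
    | zero => simp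
    | succ n ih =>
      obtain ⟨h1, h2⟩ := ih
      refine ⟨h2, ?_⟩
      rw [show n + 1 + 1 = n + 2 from rfl, chebX_add_two, chebX_add_two, h1, h2]
      ring
  exact (key n).1

/-- `2 cosh t · cosh(a t) = cosh((a+1) t) + cosh((a-1) t)`. [folklore] -/
theorem two_mul_cosh_mul_cosh (a t : ℝ) :
    2 * cosh t * cosh (a * t) = cosh ((a + 1) * t) + cosh ((a - 1) * t) := by
  rw [add_mul, sub_mul, one_mul, cosh_add, cosh_sub]
  ring

/-- **`X_n` at `2 cosh t`, two-step form**: `X_{n+2}(2cosh t) = X_n(2cosh t) + 2cosh((n+2)t)`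
(the hyperbolic counterpart of `2cos((n+2)θ) = U_{n+2}(cos θ) - U_n(cos θ)`). [folklore] -/
theorem chebX_add_two_two_mul_cosh (n : ℕ) (t : ℝ) :
    chebX (n + 2) (2 * cosh t) = chebX n (2 * cosh t) + 2 * cosh (((n : ℝ) + 2) * t) := by
  have key : ∀ n : ℕ,
      chebX (n + 2) (2 * cosh t) = chebX n (2 * cosh t) + 2 * cosh (((n : ℝ) + 2) * t) ∧
      chebX (n + 3) (2 * cosh t) = chebX (n + 1) (2 * cosh t) + 2 * cosh (((n : ℝ) + 3) * t) := by
    intro n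
    induction n with
    | zero =>
      refine ⟨?_, ?_⟩
      · rw [show (0 : ℕ) + 2 = 0 + 2 from rfl, chebX_add_two, chebX_one, chebX_zero]
        push_cast
        rw [zero_add, cosh_two_mul]
        nlinarith [cosh_sq t]
      · rw [show (0 : ℕ) + 3 = 1 + 2 from rfl, chebX_add_two, show 1 + 1 = 0 + 2 from rfl,
          chebX_add_two, chebX_one, chebX_zero]
        push_cast
        rw [zero_add, cosh_three_mul]
        ring
    | succ n ih =>
      obtain ⟨h1, h2⟩ := ih
      refine ⟨?_, ?_⟩
      · rw [show n + 1 + 2 = n + 3 from rfl, h2]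
        push_cast
        ring_nf
      · have r1 := chebX_add_two (n + 2) (2 * cosh t)
        have r0 := chebX_add_two n (2 * cosh t)
        have e := two_mul_cosh_mul_cosh ((n : ℝ) + 3) t
        have e1 : cosh (((n : ℝ) + 3 + 1) * t) = cosh (((n : ℝ) + 4) * t) := by
          congr 1; ring
        have e2 : cosh (((n : ℝ) + 3 - 1) * t) = cosh (((n : ℝ) + 2) * t) := by
          congr 1; ring
        rw [e1, e2] at e
        have e3 : cosh ((((n + 1 : ℕ) : ℝ) + 3) * t) = cosh (((n : ℝ) + 4) * t) := by
          congr 1; push_cast; ring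
        rw [show n + 1 + 3 = n + 2 + 2 from rfl, e3, show n + 1 + 1 = n + 2 from rfl]
        rw [show n + 2 + 1 = n + 3 from rfl] at r1
        linear_combination r1 + (2 * cosh t) * h2 - r0 - h1 + 2 * e
  exact (key n).1

/-- `X_n(2cosh t) ≥ n + 1` for every real `t`. [folklore] -/
theorem succ_le_chebX_two_mul_cosh (n : ℕ) (t : ℝ) : (n : ℝ) + 1 ≤ chebX n (2 * cosh t) := by
  have key : ∀ n : ℕ, (n : ℝ) + 1 ≤ chebX n (2 * cosh t) ∧
      (n : ℝ) + 1 + 1 ≤ chebX (n + 1) (2 * cosh t) := by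
    intro n
    induction n with
    | zero =>
      refine ⟨by simp, ?_⟩
      rw [zero_add, chebX_one]
      push_cast
      linarith [one_le_cosh t]
    | succ n ih =>
      obtain ⟨h1, h2⟩ := ih
      refine ⟨by exact_mod_cast h2, ?_⟩
      rw [show n + 1 + 1 = n + 2 from rfl, chebX_add_two_two_mul_cosh]
      push_cast
      linarith [one_le_cosh (((n : ℝ) + 2) * t)]
  exact (key n).1

/-- **Growth off the spectrum.** For `t ≥ 0` and `M ≤ m`: `X_{m+1+j}(2cosh t) - (m + 2 + j) ≥
j (cosh(M t) - 1)` — each of the `j` top hyperbolic cosines in `X_n(2cosh t) = Σ 2cosh(kt)` exceeds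
`cosh(Mt)`. [folklore] -/
theorem mul_cosh_sub_one_le_chebX (M m : ℕ) (hMm : M ≤ m) {t : ℝ} (ht : 0 ≤ t) (j : ℕ) :
    (j : ℝ) * (cosh (M * t) - 1) ≤ chebX (m + 1 + j) (2 * cosh t) - ((m : ℝ) + 2 + j) := by
  have hmono : ∀ k : ℕ, M ≤ k → cosh (M * t) ≤ cosh ((k : ℝ) * t) := by
    intro k hk
    rw [cosh_le_cosh, abs_of_nonneg (by positivity), abs_of_nonneg (by positivity)]
    exact mul_le_mul_of_nonneg_right (by exact_mod_cast hk) ht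
  have key : ∀ j : ℕ,
      (j : ℝ) * (cosh (M * t) - 1) ≤ chebX (m + 1 + j) (2 * cosh t) - ((m : ℝ) + 2 + j) ∧
      ((j : ℝ) + 1) * (cosh (M * t) - 1) ≤
        chebX (m + 1 + (j + 1)) (2 * cosh t) - ((m : ℝ) + 2 + (j + 1)) := by
    intro j
    induction j with
    | zero =>
      refine ⟨?_, ?_⟩
      · have h := succ_le_chebX_two_mul_cosh (m + 1) t
        push_cast at h ⊢
        linarith
      · rw [show m + 1 + (0 + 1) = m + 2 from rfl, chebX_add_two_two_mul_cosh]
        have h := succ_le_chebX_two_mul_cosh m t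
        have h2 := hmono (m + 2) (by omega)
        have h3 := one_le_cosh ((M : ℝ) * t)
        push_cast at h h2 ⊢
        linarith
    | succ j ih =>
      obtain ⟨_, h2⟩ := ih
      refine ⟨by exact_mod_cast h2, ?_⟩
      rw [show m + 1 + (j + 1 + 1) = (m + 1 + j) + 2 by ring, chebX_add_two_two_mul_cosh]
      have h3 := hmono (m + 1 + j + 2) (by omega)
      have h4 := one_le_cosh ((M : ℝ) * t)
      push_cast at h2 h3 ⊢
      nlinarith
  exact (key j).1

/-- **The key comparison.** For `t ≥ 0`, `d ≤ M` and `n = 2M + 3`: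
`2cosh(d t) - 2 ≤ 2 ((X_n(2cosh t)/(n+1))² - 1)`. [folklore] -/
theorem two_mul_cosh_sub_two_le (M d : ℕ) (hd : d ≤ M) {t : ℝ} (ht : 0 ≤ t) :
    2 * cosh (d * t) - 2 ≤
      2 * ((chebX (2 * M + 3) (2 * cosh t) / (2 * M + 3 + 1)) ^ 2 - 1) := by
  -- `X_n - (n+1) ≥ (M+2)(cosh Mt - 1)` with `n = 2M+3 = M + 1 + (M + 2)`
  have h := mul_cosh_sub_one_le_chebX M M le_rfl ht (M + 2)
  rw [show M + 1 + (M + 2) = 2 * M + 3 by ring] at h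
  set X := chebX (2 * M + 3) (2 * cosh t) with hX
  set c := cosh (M * t) - 1 with hc
  have hc0 : 0 ≤ c := by rw [hc]; linarith [one_le_cosh (M * t)]
  have hd' : cosh (d * t) ≤ cosh (M * t) := by
    rw [cosh_le_cosh, abs_of_nonneg (by positivity), abs_of_nonneg (by positivity)]
    exact mul_le_mul_of_nonneg_right (by exact_mod_cast hd) ht
  have hn0 : (0 : ℝ) < 2 * M + 3 + 1 := by positivity
  set G := X / (2 * M + 3 + 1) with hG
  have hXG : X = G * (2 * M + 3 + 1) := by rw [hG]; field_simp
  -- `G - 1 ≥ c/2`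
  have hG1 : c / 2 ≤ G - 1 := by
    push_cast at h
    rw [hXG] at h
    rw [div_le_iff₀ (by norm_num : (0:ℝ) < 2)]
    nlinarith
  have hG1' : 1 ≤ G := by linarith
  calc 2 * cosh (d * t) - 2 ≤ 2 * c := by rw [hc]; linarith
    _ ≤ 2 * ((G - 1) * (G + 1)) := by nlinarith
    _ = 2 * (G ^ 2 - 1) := by ring

/-- For `|x| ≥ 2`... exceptional points: `1 ≤ (X_n(x)/(n+1))²`. [folklore] -/
theorem one_le_sq_chebX_div (n : ℕ) (t : ℝ) :
    1 ≤ (chebX n (2 * cosh t) / (n + 1)) ^ 2 := by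
  have h := succ_le_chebX_two_mul_cosh n t
  have hn : (0 : ℝ) < n + 1 := by positivity
  have h1 : 1 ≤ chebX n (2 * cosh t) / (n + 1) := by rwa [le_div_iff₀ hn, one_mul]
  nlinarith

/-! ### Exceptional points of a real family: counting and Weyl-sum perturbation -/

/-- A point `x ≥ 2` is `2cosh t`, `t = arcosh(x/2) ≥ 0`. [folklore] -/
theorem eq_two_mul_cosh_arcosh {x : ℝ} (hx : 2 ≤ x) : x = 2 * cosh (arcosh (x / 2)) := by
  rw [cosh_arcosh (by linarith)]
  ring

/-- Off `[-2, 2]` the normalised square `(X_n(x)/(n+1))²` is at least `1`. [folklore] -/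
theorem one_le_sq_chebX_div_of_two_lt_abs (n : ℕ) {x : ℝ} (hx : 2 < |x|) :
    1 ≤ (chebX n x / (n + 1)) ^ 2 := by
  rcases le_or_gt 0 x with h0 | h0
  · rw [abs_of_nonneg h0] at hx
    rw [eq_two_mul_cosh_arcosh hx.le]
    exact one_le_sq_chebX_div n _
  · rw [abs_of_neg h0] at hx
    have hx' : x = -(2 * cosh (arcosh (-x / 2))) := by
      rw [cosh_arcosh (by linarith)]
      ring
    rw [hx', chebX_neg, mul_div_assoc, mul_pow, ← pow_mul, mul_comm n 2, pow_mul, neg_one_sq,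
      one_pow, one_mul]
    exact one_le_sq_chebX_div n _

/-- The indicator of the exceptional set is dominated by `(X_n(x)/(n+1))²`. [folklore] -/
theorem indicator_two_lt_abs_le (n : ℕ) (x : ℝ) :
    (if 2 < |x| then (1 : ℝ) else 0) ≤ chebX n x ^ 2 / ((n : ℝ) + 1) ^ 2 := by
  split_ifs with h
  · rw [← div_pow]
    exact one_le_sq_chebX_div_of_two_lt_abs n h
  · positivity

/-- **Weyl-sum perturbation of one clamped point, frequency `d = k + 2 ≤ M`.** With
`θ = arccos(x/2)` (so that a point off `[-2, 2]` is clamped to the nearer endpoint `±2`):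
`|(X_{k+2}(x) - X_k(x)) - 2cos((k+2)θ)| ≤ 2 X_n(x)²/(n+1)²`, `n = 2M + 3` — zero on `[-2, 2]`,
and `2cosh((k+2)t) - 2 ≤ 2((X_n(2cosh t)/(n+1))² - 1)` off it. [folklore] -/
theorem abs_weylTerm_sub_le (M k : ℕ) (hk : k + 2 ≤ M) (x : ℝ) :
    |(chebX (k + 2) x - chebX k x) - 2 * Real.cos ((k + 2 : ℕ) * Real.arccos (x / 2))| ≤
      2 * (chebX (2 * M + 3) x ^ 2 / ((2 * M + 3 : ℕ) + 1) ^ 2) := by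
  rcases le_or_gt (|x|) 2 with hin | hout
  · -- inside: the term vanishes
    obtain ⟨h1, h2⟩ := abs_le.mp hin
    have hcos : Real.cos (Real.arccos (x / 2)) = x / 2 := Real.cos_arccos (by linarith) (by linarith)
    have h := two_mul_cos_add_two_mul (Real.arccos (x / 2)) k
    rw [hcos, ← chebX_eq_eval_U, ← chebX_eq_eval_U] at h
    rw [← h, sub_self, abs_zero]
    positivity
  · rcases le_or_gt 0 x with h0 | h0
    · -- `x > 2`: `x = 2cosh t`, `θ = 0`
      rw [abs_of_nonneg h0] at hout
      set t := arcosh (x / 2) with ht_def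
      have ht0 : 0 ≤ t := arcosh_nonneg (by linarith)
      have hx : x = 2 * cosh t := eq_two_mul_cosh_arcosh hout.le
      have hθ : Real.arccos (x / 2) = 0 := Real.arccos_of_one_le (by linarith)
      rw [hθ, mul_zero, Real.cos_zero, mul_one, hx, chebX_add_two_two_mul_cosh, add_sub_cancel_left]
      have key := two_mul_cosh_sub_two_le M (k + 2) hk ht0
      have hnn : 0 ≤ 2 * cosh (((k : ℝ) + 2) * t) - 2 := by
        linarith [one_le_cosh (((k : ℝ) + 2) * t)]
      push_cast at key ⊢
      rw [abs_of_nonneg hnn]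
      refine key.trans ?_
      rw [div_pow]
      nlinarith [sq_nonneg (chebX (2 * M + 3) (2 * cosh t)), sq_nonneg ((2 : ℝ) * M + 3 + 1)]
    · -- `x < -2`: `x = -2cosh t`, `θ = π`
      rw [abs_of_neg h0] at hout
      set t := arcosh (-x / 2) with ht_def
      have ht0 : 0 ≤ t := arcosh_nonneg (by linarith)
      have hx : x = -(2 * cosh t) := by rw [ht_def, cosh_arcosh (by linarith)]; ring
      have hθ : Real.arccos (x / 2) = π := Real.arccos_of_le_neg_one (by linarith)
      rw [hθ, Real.cos_nat_mul_pi, hx, chebX_neg, chebX_neg, chebX_neg, chebX_add_two_two_mul_cosh]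
      have key := two_mul_cosh_sub_two_le M (k + 2) hk ht0
      have hnn : 0 ≤ 2 * cosh (((k : ℝ) + 2) * t) - 2 := by
        linarith [one_le_cosh (((k : ℝ) + 2) * t)]
      have habs : |(-1 : ℝ) ^ (k + 2) * (chebX k (2 * cosh t) + 2 * cosh (((k : ℝ) + 2) * t)) -
          (-1) ^ k * chebX k (2 * cosh t) - 2 * (-1) ^ (k + 2)| =
          2 * cosh (((k : ℝ) + 2) * t) - 2 := by
        rw [pow_add, neg_one_sq, mul_one]
        have : (-1 : ℝ) ^ k * (chebX k (2 * cosh t) + 2 * cosh (((k : ℝ) + 2) * t)) -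
            (-1) ^ k * chebX k (2 * cosh t) - 2 * (-1) ^ k =
            (-1) ^ k * (2 * cosh (((k : ℝ) + 2) * t) - 2) := by ring
        rw [this, abs_mul, abs_pow, abs_neg, abs_one, one_pow, one_mul, abs_of_nonneg hnn]
      push_cast at key habs ⊢
      rw [habs]
      refine key.trans ?_
      rw [mul_pow, ← pow_mul, mul_comm (2 * M + 3) 2, pow_mul, neg_one_sq, one_pow, one_mul,
        div_pow]
      nlinarith [sq_nonneg (chebX (2 * M + 3) (2 * cosh t)), sq_nonneg ((2 : ℝ) * M + 3 + 1)]

/-- The same for the frequency `d = 1` (`X_1(x) = x`, `X_{-1} = 0`). [folklore] -/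
theorem abs_weylTerm_one_sub_le (M : ℕ) (hM : 1 ≤ M) (x : ℝ) :
    |chebX 1 x - 2 * Real.cos (Real.arccos (x / 2))| ≤
      2 * (chebX (2 * M + 3) x ^ 2 / ((2 * M + 3 : ℕ) + 1) ^ 2) := by
  rcases le_or_gt (|x|) 2 with hin | hout
  · obtain ⟨h1, h2⟩ := abs_le.mp hin
    rw [Real.cos_arccos (by linarith) (by linarith), chebX_one, mul_div_cancel₀ _ two_ne_zero,
      sub_self, abs_zero]
    positivity
  · rcases le_or_gt 0 x with h0 | h0
    · rw [abs_of_nonneg h0] at hout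
      set t := arcosh (x / 2) with ht_def
      have ht0 : 0 ≤ t := arcosh_nonneg (by linarith)
      have hx : x = 2 * cosh t := eq_two_mul_cosh_arcosh hout.le
      have hθ : Real.arccos (x / 2) = 0 := Real.arccos_of_one_le (by linarith)
      rw [hθ, Real.cos_zero, mul_one, chebX_one, hx]
      have key := two_mul_cosh_sub_two_le M 1 hM ht0
      have hnn : 0 ≤ 2 * cosh t - 2 := by linarith [one_le_cosh t]
      push_cast at key ⊢
      rw [one_mul] at key
      rw [abs_of_nonneg hnn]
      refine key.trans ?_
      rw [div_pow]
      nlinarith [sq_nonneg (chebX (2 * M + 3) (2 * cosh t)), sq_nonneg ((2 : ℝ) * M + 3 + 1)]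
    · rw [abs_of_neg h0] at hout
      set t := arcosh (-x / 2) with ht_def
      have ht0 : 0 ≤ t := arcosh_nonneg (by linarith)
      have hx : x = -(2 * cosh t) := by rw [ht_def, cosh_arcosh (by linarith)]; ring
      have hθ : Real.arccos (x / 2) = π := Real.arccos_of_le_neg_one (by linarith)
      rw [hθ, Real.cos_pi, chebX_one, hx, chebX_neg]
      have key := two_mul_cosh_sub_two_le M 1 hM ht0
      have hnn : 0 ≤ 2 * cosh t - 2 := by linarith [one_le_cosh t]
      have habs : |-(2 * cosh t) - 2 * (-1 : ℝ)| = 2 * cosh t - 2 := by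
        rw [show -(2 * cosh t) - 2 * (-1 : ℝ) = -(2 * cosh t - 2) by ring, abs_neg,
          abs_of_nonneg hnn]
      push_cast at key ⊢
      rw [one_mul] at key
      rw [habs]
      refine key.trans ?_
      rw [mul_pow, ← pow_mul, mul_comm (2 * M + 3) 2, pow_mul, neg_one_sq, one_pow, one_mul,
        div_pow]
      nlinarith [sq_nonneg (chebX (2 * M + 3) (2 * cosh t)), sq_nonneg ((2 : ℝ) * M + 3 + 1)]

section ExceptionalFamily

variable {ι : Type*} [Fintype ι]

/-- **Second moment of `X_n` along a family from its Chebyshev moments**: if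
`|Σ_i X_c(x_i) - r γ_c| ≤ E` for `c ≤ 2n` (`γ_c = p^{-c/2}` for even `c`, `0` for odd `c`, `p ≥ 2`),
then `Σ_i X_n(x_i)² ≤ 2r + (n+1)E`, by the linearisation `X_n² = Σ_{j ≤ n} X_{2j}` and
`Σ_j p^{-j} ≤ 2`. [folklore] -/
theorem sum_chebX_sq_le (x : ι → ℝ) {p : ℝ} (hp : 2 ≤ p) (n : ℕ) {E : ℝ}
    (hmom : ∀ c : ℕ, c ≤ 2 * n →
      |∑ i, chebX c (x i) - Fintype.card ι * (if Even c then (Real.sqrt p)⁻¹ ^ c else 0)| ≤ E) :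
    ∑ i, chebX n (x i) ^ 2 ≤ 2 * Fintype.card ι + (n + 1) * E := by
  set q : ℝ := (Real.sqrt p)⁻¹ with hq
  have hs0 : 0 < Real.sqrt p := Real.sqrt_pos.mpr (by linarith)
  have hq0 : 0 ≤ q := by positivity
  have hq2 : q ^ 2 ≤ 1 / 2 := by
    rw [hq, inv_pow, Real.sq_sqrt (by linarith), inv_eq_one_div]
    exact one_div_le_one_div_of_le (by norm_num) hp
  -- linearisation
  have hlin : ∀ i, chebX n (x i) ^ 2 = ∑ j ∈ range (n + 1), chebX (n + n - 2 * j) (x i) := by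
    intro i
    rw [sq, chebX_mul_chebX, min_self]
  simp_rw [hlin]
  rw [Finset.sum_comm]
  -- each inner sum is `≤ r q^{2(n-j)} + E`
  have hinner : ∀ j ∈ range (n + 1), ∑ i, chebX (n + n - 2 * j) (x i) ≤
      Fintype.card ι * (q ^ 2) ^ (n - j) + E := by
    intro j hj
    have hj' : j ≤ n := Nat.lt_succ_iff.mp (Finset.mem_range.mp hj)
    have h := hmom (n + n - 2 * j) (by omega)
    have heven : Even (n + n - 2 * j) := ⟨n - j, by omega⟩
    rw [if_pos heven] at h
    have hpow : q ^ (n + n - 2 * j) = (q ^ 2) ^ (n - j) := by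
      rw [← pow_mul]; congr 1; omega
    rw [hpow] at h
    linarith [(abs_le.mp h).2]
  refine (Finset.sum_le_sum hinner).trans ?_
  rw [Finset.sum_add_distrib, Finset.sum_const, Finset.card_range, nsmul_eq_mul, ← Finset.mul_sum]
  -- `Σ_{j ≤ n} (q²)^{n-j} = Σ_{k ≤ n} (q²)^k ≤ 2`
  have hgeom : ∑ j ∈ range (n + 1), (q ^ 2) ^ (n - j) ≤ 2 := by
    have hrefl : ∑ j ∈ range (n + 1), (q ^ 2) ^ (n - j) = ∑ k ∈ range (n + 1), (q ^ 2) ^ k := by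
      have h := Finset.sum_range_reflect (fun k => (q ^ 2) ^ k) (n + 1)
      simp only [Nat.add_sub_cancel] at h
      rw [← h]
    rw [hrefl]
    calc ∑ k ∈ range (n + 1), (q ^ 2) ^ k ≤ 1 / (1 - q ^ 2) :=
          geom_sum_range_le (by positivity) (by linarith) (n + 1)
      _ ≤ 2 := by
          rw [div_le_iff₀ (by linarith)]; linarith
  have hr : (0 : ℝ) ≤ Fintype.card ι := by positivity
  push_cast
  nlinarith [mul_le_mul_of_nonneg_left hgeom hr]

/-- **Few exceptional points**: `#{i : |x_i| > 2} ≤ Σ_i X_n(x_i)²/(n+1)²`. [folklore] -/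
theorem card_filter_two_lt_abs_le (x : ι → ℝ) (n : ℕ) :
    ((Finset.univ.filter fun i => 2 < |x i|).card : ℝ) ≤
      (∑ i, chebX n (x i) ^ 2) / ((n : ℝ) + 1) ^ 2 := by
  classical
  have h : ((Finset.univ.filter fun i => 2 < |x i|).card : ℝ) =
      ∑ i, (if 2 < |x i| then (1 : ℝ) else 0) := by
    rw [Finset.sum_boole]
  rw [h, Finset.sum_div]
  exact Finset.sum_le_sum fun i _ => indicator_two_lt_abs_le n (x i)


end ExceptionalFamily

section IntervalCount

variable {ι : Type*} [Fintype ι]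

/-- **The circle side of Murty–Sinha Thm. 19 (Thm. 8 inserted), for any family of angles.** Let
`θ_i ∈ [0, π]` (`i ∈ ι`, `r = #ι`), `p ≥ 2`, and suppose the cosine Weyl sums of the symmetrised
family `±θ_i` against `g_p` are within `W` for the frequencies `1 ≤ d ≤ M`:
`|Σ_i 2cos(dθ_i) - 2r ∫ g_p cos(d·)| ≤ W` (the sine Weyl sums vanish identically by symmetry). Then
for `0 ≤ θ_b ≤ θ_a ≤ π`, `|#{i : θ_i ∈ [θ_b, θ_a]} - r ∫_{θ_b}^{θ_a} 2g_p| ≤ 288 r/(M+1) + (3/2)(M+1)W`: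
the Erdős–Turán inequality `Literature.Analysis.Fourier.abs_ceilCount_sub_integral_le` for the `2r`
points `±θ_i` (`g_p ≤ 6/π`), applied to the `δ`-enlarged and `δ`-shrunken arcs of
`two_mul_card_le_arcCount` / `arcCount_le_two_mul_card`, and `δ → 0` (the argument of
`abs_card_Icc_sub_integral_le`, with the Weyl bound kept abstract). [cite: MurtySinha2009, Thm. 19
p. 701 (variant)] -/
theorem abs_card_filter_Icc_sub_integral_le_of_weyl (θ : ι → ℝ) (hθmem : ∀ i, θ i ∈ Set.Icc 0 π)
    {p : ℝ} (hp : 2 ≤ p) {M : ℕ} {W : ℝ} (hW0 : 0 ≤ W)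
    (hW : ∀ d : ℕ, 1 ≤ d → d ≤ M →
      |(∑ i, Real.cos (d * θ i) + ∑ i, Real.cos (d * -θ i)) -
        (2 * Fintype.card ι) * ∫ t in (-π)..π, kmDensity p t * Real.cos (d * t)| ≤ W)
    {θa θb : ℝ} (hθb0 : 0 ≤ θb) (hθba : θb ≤ θa) (hθaπ : θa ≤ π) :
    |((Finset.univ.filter fun i => θ i ∈ Set.Icc θb θa).card : ℝ) -
        Fintype.card ι * ∫ t in θb..θa, 2 * kmDensity p t|
      ≤ 288 * Fintype.card ι / (M + 1) + 3 / 2 * (M + 1) * W := by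
  classical
  have hp1 : 1 < p := by linarith
  have hπ := Real.pi_pos
  set N : ℝ := ((Finset.univ.filter fun i => θ i ∈ Set.Icc θb θa).card : ℝ) with hN
  -- the Erdős–Turán bound for the points `±θ_i`
  set P : ι ⊕ ι → ℝ := Sum.elim θ (fun i => -θ i) with hP
  set r : ℝ := (Fintype.card ι : ℝ) with hr
  have hn : (Fintype.card (ι ⊕ ι) : ℝ) = 2 * r := by
    rw [Fintype.card_sum, hr]; push_cast; ring
  have hg := continuous_kmDensity hp1
  have hGle : ∀ t, kmDensity p t ≤ 6 / π := kmDensity_le_six_div_pi hp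
  have hF : ∀ d : ℕ, 1 ≤ d → d ≤ M →
      |∑ j, Real.cos (d * P j) - Fintype.card (ι ⊕ ι) *
          ∫ t in (-π)..π, kmDensity p t * Real.cos (d * t)| ≤ W ∧
      |∑ j, Real.sin (d * P j) - Fintype.card (ι ⊕ ι) *
          ∫ t in (-π)..π, kmDensity p t * Real.sin (d * t)| ≤ W := by
    intro d hd1 hdM
    rw [hn, Fintype.sum_sum_type, Fintype.sum_sum_type]
    simp only [hP, Sum.elim_inl, Sum.elim_inr]
    refine ⟨hW d hd1 hdM, ?_⟩
    have h := abs_weyl_sin_le θ p d (E := W / 2) (by positivity)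
    rw [hr]
    linarith
  set Bnd : ℝ := 24 * π * (2 * r * (6 / π)) / (M + 1) + 4 * (M + 1) * W / π with hBnd
  have ET : ∀ u v : ℝ, |∑ j, arcCount u v (P j) - 2 * r * ∫ t in u..v, kmDensity p t| ≤ Bnd := by
    intro u v
    have h := abs_ceilCount_sub_integral_le P hg (kmDensity_periodic p) (integral_kmDensity hp1)
      (by positivity : (0 : ℝ) ≤ 6 / π) hGle hW0 hF u v
    rw [hn] at h
    convert h using 3
    simp only [arcCount]
  have hBnd_le : Bnd ≤ 288 * r / (M + 1) + 3 / 2 * (M + 1) * W := by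
    rw [hBnd]
    have hM : (0 : ℝ) < M + 1 := by positivity
    have e1 : 24 * π * (2 * r * (6 / π)) / (M + 1) = 288 * r / (M + 1) := by
      field_simp; ring
    have e2 : 4 * (M + 1) * W / π ≤ 3 / 2 * (M + 1) * W := by
      rw [div_le_iff₀ hπ]
      have : (8 : ℝ) ≤ 3 * π := by linarith [Real.pi_gt_three]
      nlinarith [mul_nonneg hM.le hW0]
    linarith
  -- arc sums split over `ι ⊕ ι`
  have hsplit : ∀ u v : ℝ, ∑ j, arcCount u v (P j) =
      ∑ i, (arcCount u v (θ i) + arcCount u v (-θ i)) := by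
    intro u v
    rw [Fintype.sum_sum_type, ← Finset.sum_add_distrib]
    simp only [hP, Sum.elim_inl, Sum.elim_inr]
  -- pieces of integrals
  have hint : ∀ u v, IntervalIntegrable (kmDensity p) volume u v := fun u v => hg.intervalIntegrable u v
  have hsmall : ∀ u δ : ℝ, 0 ≤ δ → ∫ t in u..u + δ, kmDensity p t ≤ 6 / π * δ := by
    intro u δ hδ
    have h := intervalIntegral.integral_mono_on (by linarith) (hint u (u + δ))
      (intervalIntegrable_const : IntervalIntegrable (fun _ => 6 / π) volume u (u + δ))
      (fun t _ => hGle t)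
    rw [intervalIntegral.integral_const, smul_eq_mul] at h
    linarith [show (u + δ - u) * (6 / π) = 6 / π * δ by ring]
  have hsmall' : ∀ u δ : ℝ, 0 ≤ δ → 0 ≤ ∫ t in u..u + δ, kmDensity p t := fun u δ hδ =>
    intervalIntegral.integral_nonneg (by linarith) fun t _ => kmDensity_nonneg hp1 t
  have hrefl : ∫ t in (-θa)..(-θb), kmDensity p t = ∫ t in θb..θa, kmDensity p t := by
    rw [← intervalIntegral.integral_comp_neg]
    simp_rw [kmDensity_neg]
  set I : ℝ := ∫ t in θb..θa, kmDensity p t with hI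
  have hmain : ∀ δ : ℝ, 0 < δ → δ ≤ π → |N - 2 * r * I| ≤ Bnd + 2 * r * (6 / π) * δ := by
    intro δ hδ hδπ
    have hr0 : 0 ≤ r := by rw [hr]; positivity
    -- upper
    have hup := two_mul_card_le_arcCount θ hθmem hθb0 hθba hθaπ hδ hδπ
    have E1 := ET θb (θa + δ)
    have E2 := ET (-θa) (-θb + δ)
    rw [hsplit] at E1 E2
    have i1 : ∫ t in θb..(θa + δ), kmDensity p t = I + ∫ t in θa..(θa + δ), kmDensity p t :=
      (intervalIntegral.integral_add_adjacent_intervals (hint _ _) (hint _ _)).symm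
    have i2 : ∫ t in (-θa)..(-θb + δ), kmDensity p t = I + ∫ t in (-θb)..(-θb + δ), kmDensity p t := by
      rw [← intervalIntegral.integral_add_adjacent_intervals (hint (-θa) (-θb)) (hint _ _), hrefl]
    have s1 := hsmall θa δ hδ.le
    have s2 := hsmall (-θb) δ hδ.le
    -- lower
    have hlo := arcCount_le_two_mul_card θ hθmem hθb0 hθaπ hδ hδπ
    have E3 := ET (θb + δ) θa
    have E4 := ET (-θa + δ) (-θb)
    rw [hsplit] at E3 E4
    have i3 : ∫ t in (θb + δ)..θa, kmDensity p t = I - ∫ t in θb..(θb + δ), kmDensity p t := by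
      have h := intervalIntegral.integral_add_adjacent_intervals (hint θb (θb + δ))
        (hint (θb + δ) θa)
      rw [← hI] at h
      linarith
    have i4 : ∫ t in (-θa + δ)..(-θb), kmDensity p t =
        I - ∫ t in (-θa)..(-θa + δ), kmDensity p t := by
      have h := intervalIntegral.integral_add_adjacent_intervals (hint (-θa) (-θa + δ))
        (hint (-θa + δ) (-θb))
      rw [hrefl] at h
      linarith
    have s3 := hsmall θb δ hδ.le
    have s4 := hsmall (-θa) δ hδ.le
    have s3' := hsmall' θb δ hδ.le
    have s4' := hsmall' (-θa) δ hδ.le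
    have s1' := hsmall' θa δ hδ.le
    have s2' := hsmall' (-θb) δ hδ.le
    rw [i1] at E1
    rw [i2] at E2
    rw [i3] at E3
    rw [i4] at E4
    have h2r : (0 : ℝ) ≤ 2 * r := by positivity
    have m1 := mul_le_mul_of_nonneg_left s1 h2r
    have m2 := mul_le_mul_of_nonneg_left s2 h2r
    have m3 := mul_le_mul_of_nonneg_left s3 h2r
    have m4 := mul_le_mul_of_nonneg_left s4 h2r
    have m1' := mul_nonneg h2r s1'
    have m2' := mul_nonneg h2r s2'
    have m3' := mul_nonneg h2r s3'
    have m4' := mul_nonneg h2r s4'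
    have d1 : 2 * r * (I + ∫ t in θa..(θa + δ), kmDensity p t) =
        2 * r * I + 2 * r * ∫ t in θa..(θa + δ), kmDensity p t := by ring
    have d2 : 2 * r * (I + ∫ t in (-θb)..(-θb + δ), kmDensity p t) =
        2 * r * I + 2 * r * ∫ t in (-θb)..(-θb + δ), kmDensity p t := by ring
    have d3 : 2 * r * (I - ∫ t in θb..(θb + δ), kmDensity p t) =
        2 * r * I - 2 * r * ∫ t in θb..(θb + δ), kmDensity p t := by ring
    have d4 : 2 * r * (I - ∫ t in (-θa)..(-θa + δ), kmDensity p t) =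
        2 * r * I - 2 * r * ∫ t in (-θa)..(-θa + δ), kmDensity p t := by ring
    have d5 : 2 * r * (6 / π * δ) = 2 * r * (6 / π) * δ := by ring
    rw [d1] at E1
    rw [d2] at E2
    rw [d3] at E3
    rw [d4] at E4
    rw [d5] at m1 m2 m3 m4
    rw [abs_le] at E1 E2 E3 E4 ⊢
    rw [hN]
    constructor
    · linarith [E3.1, E4.1, hlo]
    · linarith [E1.2, E2.2, hup]
  -- let `δ → 0`
  have hfinal : |N - 2 * r * I| ≤ Bnd := by
    refine le_of_forall_pos_le_add fun ε hε => ?_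
    have hr0 : 0 ≤ r := by rw [hr]; positivity
    set K : ℝ := 2 * r * (6 / π) with hK
    have hK0 : 0 ≤ K := by positivity
    set δ : ℝ := min π (ε / (K + 1)) with hδ
    have hδ0 : 0 < δ := lt_min hπ (by positivity)
    have hδπ : δ ≤ π := min_le_left _ _
    have hδε : K * δ ≤ ε := by
      have h1 : δ ≤ ε / (K + 1) := min_le_right _ _
      have h2 : K * δ ≤ K * (ε / (K + 1)) := mul_le_mul_of_nonneg_left h1 hK0
      have h3 : K * (ε / (K + 1)) ≤ ε := by
        rw [mul_div_assoc', div_le_iff₀ (by positivity)]; nlinarith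
      linarith
    have := hmain δ hδ0 hδπ
    linarith
  have hI2 : r * ∫ t in θb..θa, 2 * kmDensity p t = 2 * r * I := by
    rw [intervalIntegral.integral_const_mul]; ring
  rw [hI2]
  exact hfinal.trans hBnd_le


/-- **Weyl sums of the clamped angles from Chebyshev moments (no a-priori bound on the points).**
For a real family `x_i` put `θ_i = arccos(x_i/2) ∈ [0, π]` (a point off `[-2, 2]` is clamped to
the nearer endpoint). If `|Σ_i X_c(x_i) - r γ_c| ≤ E` for `c ≤ 2(2M+3)`, then for `1 ≤ d ≤ M` the
cosine Weyl sum `Σ_i 2cos(dθ_i)` differs from `2r ∫ g_p cos(d·)` by at most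
`2E + 4(2r + (2M+4)E)/(2M+4)²`: the moment identity of `abs_weyl_cos_le` plus the perturbation
bounds `abs_weylTerm_sub_le`, `abs_weylTerm_one_sub_le`, summed by `sum_chebX_sq_le`. [folklore] -/
theorem abs_weyl_cos_clamped_le (x : ι → ℝ) {p : ℝ} (hp : 2 ≤ p) {M : ℕ} {E : ℝ} (hE : 0 ≤ E)
    (hmom : ∀ c : ℕ, c ≤ 2 * (2 * M + 3) →
      |∑ i, chebX c (x i) - Fintype.card ι * (if Even c then (Real.sqrt p)⁻¹ ^ c else 0)| ≤ E)
    {d : ℕ} (hd1 : 1 ≤ d) (hdM : d ≤ M) :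
    |(∑ i, Real.cos (d * Real.arccos (x i / 2)) + ∑ i, Real.cos (d * -Real.arccos (x i / 2))) -
        (2 * Fintype.card ι) * ∫ t in (-π)..π, kmDensity p t * Real.cos (d * t)|
      ≤ 2 * E + 2 * ((2 * Fintype.card ι + ((2 * M + 3 : ℕ) + 1) * E) /
          (((2 * M + 3 : ℕ) : ℝ) + 1) ^ 2) := by
  classical
  have hp1 : 1 < p := by linarith
  have hM : 1 ≤ M := hd1.trans hdM
  set n : ℕ := 2 * M + 3 with hn_def
  set θ : ι → ℝ := fun i => Real.arccos (x i / 2) with hθ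
  -- the per-point perturbation bounds and their sum
  set B : ι → ℝ := fun i => 2 * (chebX n (x i) ^ 2 / ((n : ℝ) + 1) ^ 2) with hB
  have hBsum : ∑ i, B i ≤ 2 * ((2 * Fintype.card ι + ((n : ℝ) + 1) * E) / ((n : ℝ) + 1) ^ 2) := by
    have hS := sum_chebX_sq_le x hp n hmom
    simp only [hB]
    rw [← Finset.mul_sum, ← Finset.sum_div]
    gcongr
  have hsym : ∑ i, Real.cos (d * -θ i) = ∑ i, Real.cos (d * θ i) :=
    Finset.sum_congr rfl fun i _ => by rw [mul_neg, Real.cos_neg]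
  show |(∑ i, Real.cos (d * θ i) + ∑ i, Real.cos (d * -θ i)) - _| ≤ _
  rw [hsym, ← two_mul, Finset.mul_sum]
  rcases Nat.exists_eq_add_of_le hd1 with ⟨k, rfl⟩
  rcases k with _ | k
  · -- `d = 1`
    have h1 := hmom 1 (by omega)
    simp only [Nat.cast_one, add_zero] at *
    rw [integral_kmDensity_mul_cos_one hp1, mul_zero, sub_zero]
    rw [if_neg (by decide), mul_zero, sub_zero] at h1
    have hδ : ∀ i, |chebX 1 (x i) - 2 * Real.cos (1 * θ i)| ≤ B i := fun i => by
      rw [one_mul]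
      exact abs_weylTerm_one_sub_le M hM (x i)
    have e : ∑ i, 2 * Real.cos (1 * θ i) =
        ∑ i, chebX 1 (x i) - ∑ i, (chebX 1 (x i) - 2 * Real.cos (1 * θ i)) := by
      rw [← Finset.sum_sub_distrib]
      exact Finset.sum_congr rfl fun i _ => by ring
    rw [e]
    calc |∑ i, chebX 1 (x i) - ∑ i, (chebX 1 (x i) - 2 * Real.cos (1 * θ i))|
        ≤ |∑ i, chebX 1 (x i)| + |∑ i, (chebX 1 (x i) - 2 * Real.cos (1 * θ i))| := abs_sub _ _
      _ ≤ E + ∑ i, B i :=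
          add_le_add h1 ((Finset.abs_sum_le_sum_abs _ _).trans (Finset.sum_le_sum fun i _ => hδ i))
      _ ≤ _ := by linarith
  · -- `d = k + 2`
    rw [show 1 + (k + 1) = k + 2 by ring] at hdM ⊢
    have hδ : ∀ i, |(chebX (k + 2) (x i) - chebX k (x i)) - 2 * Real.cos ((k + 2 : ℕ) * θ i)| ≤
        B i := fun i => abs_weylTerm_sub_le M k hdM (x i)
    have e : ∑ i, 2 * Real.cos ((k + 2 : ℕ) * θ i) =
        (∑ i, chebX (k + 2) (x i) - ∑ i, chebX k (x i)) -
          ∑ i, ((chebX (k + 2) (x i) - chebX k (x i)) - 2 * Real.cos ((k + 2 : ℕ) * θ i)) := by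
      rw [← Finset.sum_sub_distrib, ← Finset.sum_sub_distrib]
      exact Finset.sum_congr rfl fun i _ => by ring
    rw [e, show (2 : ℝ) * Fintype.card ι * _ = Fintype.card ι *
      (2 * ∫ t in (-π)..π, kmDensity p t * Real.cos ((k + 2 : ℕ) * t)) by ring,
      two_mul_integral_kmDensity_mul_cos hp1 k]
    have h1 := hmom (k + 2) (by omega)
    have h2 := hmom k (by omega)
    calc _ = |(∑ i, chebX (k + 2) (x i) -
          Fintype.card ι * (if Even (k + 2) then (Real.sqrt p)⁻¹ ^ (k + 2) else 0)) -
          (∑ i, chebX k (x i) - Fintype.card ι * (if Even k then (Real.sqrt p)⁻¹ ^ k else 0)) -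
          ∑ i, ((chebX (k + 2) (x i) - chebX k (x i)) - 2 * Real.cos ((k + 2 : ℕ) * θ i))| := by
          congr 1; ring
      _ ≤ |(∑ i, chebX (k + 2) (x i) -
          Fintype.card ι * (if Even (k + 2) then (Real.sqrt p)⁻¹ ^ (k + 2) else 0)) -
          (∑ i, chebX k (x i) - Fintype.card ι * (if Even k then (Real.sqrt p)⁻¹ ^ k else 0))| +
          |∑ i, ((chebX (k + 2) (x i) - chebX k (x i)) - 2 * Real.cos ((k + 2 : ℕ) * θ i))| :=
          abs_sub _ _
      _ ≤ (E + E) + ∑ i, B i :=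
          add_le_add ((abs_sub _ _).trans (add_le_add h1 h2))
            ((Finset.abs_sum_le_sum_abs _ _).trans (Finset.sum_le_sum fun i _ => hδ i))
      _ ≤ _ := by linarith

set_option maxHeartbeats 400000 in
/-- **Interval counts from Chebyshev moments, without an a-priori bound on the points** (the
Deligne-free form of `abs_card_Icc_sub_integral_le`). Let `x_i ∈ ℝ` (`i ∈ ι`, `r = #ι`), `p ≥ 2`,
`E ≥ 0`, and suppose `|Σ_i X_c(x_i) - r γ_c| ≤ E` for all `c ≤ 2(2M+3)`. Then for `-2 ≤ a ≤ b ≤ 2`,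
`|#{i : x_i ∈ [a, b]} - r ∫_{arccos(b/2)}^{arccos(a/2)} 2g_p(θ) dθ| ≤ 290 r/(M+1) + 5(M+1)E`:
`abs_card_filter_Icc_sub_integral_le_of_weyl` for the clamped angles `θ_i = arccos(x_i/2)` with the
Weyl bound `abs_weyl_cos_clamped_le`, and at most `#{i : |x_i| > 2} ≤ (2r + (2M+4)E)/(2M+4)²`
clamped points mis-counted (`card_filter_two_lt_abs_le`, `sum_chebX_sq_le`). [folklore] -/
theorem abs_card_Icc_sub_integral_le_of_moments (x : ι → ℝ) {p : ℝ} (hp : 2 ≤ p)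
    {M : ℕ} {E : ℝ} (hE : 0 ≤ E)
    (hmom : ∀ c : ℕ, c ≤ 2 * (2 * M + 3) →
      |∑ i, chebX c (x i) - Fintype.card ι * (if Even c then (Real.sqrt p)⁻¹ ^ c else 0)| ≤ E)
    {a b : ℝ} (ha : -2 ≤ a) (hab : a ≤ b) (hb : b ≤ 2) :
    |((Finset.univ.filter fun i => x i ∈ Set.Icc a b).card : ℝ) -
        Fintype.card ι * ∫ θ in Real.arccos (b / 2)..Real.arccos (a / 2), 2 * kmDensity p θ|
      ≤ 290 * Fintype.card ι / (M + 1) + 5 * (M + 1) * E := by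
  classical
  have hp1 : 1 < p := by linarith
  set n : ℕ := 2 * M + 3 with hn_def
  set r : ℝ := (Fintype.card ι : ℝ) with hr
  have hr0 : 0 ≤ r := by rw [hr]; positivity
  -- the clamped angles
  set θ : ι → ℝ := fun i => Real.arccos (x i / 2) with hθ
  have hθmem : ∀ i, θ i ∈ Set.Icc 0 π := fun i => ⟨Real.arccos_nonneg _, Real.arccos_le_pi _⟩
  set θa := Real.arccos (a / 2) with hθa
  set θb := Real.arccos (b / 2) with hθb
  have hθb0 : 0 ≤ θb := Real.arccos_nonneg _
  have hθaπ : θa ≤ π := Real.arccos_le_pi _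
  have hθba : θb ≤ θa := Real.arccos_le_arccos (by linarith)
  -- on `[-2, 2]`: `x_i ∈ [a, b] ↔ θ_i ∈ [θ_b, θ_a]`
  have hmemI : ∀ i, |x i| ≤ 2 → (x i ∈ Set.Icc a b ↔ θ i ∈ Set.Icc θb θa) := by
    intro i hxi
    obtain ⟨hx1, hx2⟩ := abs_le.mp hxi
    have ha' : a / 2 ∈ Set.Icc (-1 : ℝ) 1 := ⟨by linarith, by linarith⟩
    have hb' : b / 2 ∈ Set.Icc (-1 : ℝ) 1 := ⟨by linarith, by linarith⟩
    have hxi' : x i / 2 ∈ Set.Icc (-1 : ℝ) 1 := ⟨by linarith, by linarith⟩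
    rw [Set.mem_Icc, Set.mem_Icc, hθ, hθa, hθb]
    simp only
    rw [StrictAntiOn.le_iff_ge Real.strictAntiOn_arccos hb' hxi',
      StrictAntiOn.le_iff_ge Real.strictAntiOn_arccos hxi' ha']
    constructor <;> rintro ⟨h1, h2⟩ <;> constructor <;> linarith
  -- so the two counts differ by at most the number of exceptional points
  set Sx := (Finset.univ.filter fun i => x i ∈ Set.Icc a b) with hSx
  set Sθ := (Finset.univ.filter fun i => θ i ∈ Set.Icc θb θa) with hSθ
  set Sexc := (Finset.univ.filter fun i => 2 < |x i|) with hSexc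
  have hsub1 : Sx ⊆ Sθ := by
    intro i hi
    rw [hSx, Finset.mem_filter] at hi
    rw [hSθ, Finset.mem_filter]
    have hxi : |x i| ≤ 2 := abs_le.mpr ⟨by linarith [hi.2.1], by linarith [hi.2.2]⟩
    exact ⟨hi.1, (hmemI i hxi).mp hi.2⟩
  have hsub2 : Sθ ⊆ Sx ∪ Sexc := by
    intro i hi
    rw [hSθ, Finset.mem_filter] at hi
    rw [Finset.mem_union, hSx, hSexc, Finset.mem_filter, Finset.mem_filter]
    rcases le_or_gt (|x i|) 2 with hxi | hxi
    · exact Or.inl ⟨hi.1, (hmemI i hxi).mpr hi.2⟩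
    · exact Or.inr ⟨hi.1, hxi⟩
  have hc1 : (Sx.card : ℝ) ≤ Sθ.card := by exact_mod_cast Finset.card_le_card hsub1
  have hc2 : (Sθ.card : ℝ) ≤ Sx.card + Sexc.card := by
    have h := (Finset.card_le_card hsub2).trans (Finset.card_union_le _ _)
    exact_mod_cast h
  -- the exceptional count
  have hS := sum_chebX_sq_le x hp n hmom
  have hexc : (Sexc.card : ℝ) ≤ (2 * r + ((n : ℝ) + 1) * E) / ((n : ℝ) + 1) ^ 2 := by
    refine (card_filter_two_lt_abs_le x n).trans ?_
    gcongr
  -- the circle side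
  set W : ℝ := 2 * E + 2 * ((2 * r + ((n : ℝ) + 1) * E) / ((n : ℝ) + 1) ^ 2) with hW_def
  have hW0 : 0 ≤ W := by rw [hW_def]; positivity
  have hW : ∀ d : ℕ, 1 ≤ d → d ≤ M →
      |(∑ i, Real.cos (d * θ i) + ∑ i, Real.cos (d * -θ i)) -
        (2 * Fintype.card ι) * ∫ t in (-π)..π, kmDensity p t * Real.cos (d * t)| ≤ W := by
    intro d hd1 hdM
    have h := abs_weyl_cos_clamped_le x hp hE hmom hd1 hdM
    rw [hW_def, hr]
    convert h using 2
  have hcirc := abs_card_filter_Icc_sub_integral_le_of_weyl θ hθmem hp hW0 hW hθb0 hθba hθaπ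
  -- bookkeeping: `(n+1) = 2(M+2)`
  have hn1 : ((n : ℝ) + 1) = 2 * ((M : ℝ) + 2) := by rw [hn_def]; push_cast; ring
  have hM0 : (0 : ℝ) < (M : ℝ) + 1 := by positivity
  set Q : ℝ := (2 * r + ((n : ℝ) + 1) * E) / ((n : ℝ) + 1) ^ 2 with hQ_def
  set u : ℝ := r / ((M : ℝ) + 1) with hu_def
  have hu0 : 0 ≤ u := by rw [hu_def]; positivity
  have hQeq : Q = r / (2 * ((M : ℝ) + 2) ^ 2) + E / (2 * ((M : ℝ) + 2)) := by
    rw [hQ_def, hn1]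
    field_simp
  have hfrac1 : r / (2 * ((M : ℝ) + 2) ^ 2) ≤ u / 2 := by
    rw [hu_def, div_div, div_le_div_iff₀ (by positivity) (by positivity)]
    nlinarith [hr0, sq_nonneg ((M : ℝ) + 1)]
  have hfrac2 : E / (2 * ((M : ℝ) + 2)) ≤ E / 2 :=
    div_le_div_of_nonneg_left hE (by norm_num) (by nlinarith)
  have hkey1 : Q ≤ u / 2 + E / 2 := by rw [hQeq]; exact add_le_add hfrac1 hfrac2
  have hfrac3 : ((M : ℝ) + 1) * (r / (2 * ((M : ℝ) + 2) ^ 2)) ≤ u / 2 := by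
    rw [hu_def, mul_div_assoc', div_div,
      div_le_div_iff₀ (by positivity) (by positivity)]
    nlinarith [hr0, sq_nonneg ((M : ℝ) + 1), mul_nonneg hr0 hM0.le]
  have hfrac4 : ((M : ℝ) + 1) * (E / (2 * ((M : ℝ) + 2))) ≤ E / 2 := by
    rw [mul_div_assoc', div_le_div_iff₀ (by positivity) (by positivity)]
    nlinarith [hE, mul_nonneg hM0.le hE]
  have hkey2 : ((M : ℝ) + 1) * Q ≤ u / 2 + E / 2 := by
    rw [hQeq, mul_add]; exact add_le_add hfrac3 hfrac4
  have hM1 : (1 : ℝ) ≤ (M : ℝ) + 1 := by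
    have := (Nat.cast_nonneg M : (0 : ℝ) ≤ M); linarith
  have hEv : E ≤ ((M : ℝ) + 1) * E := le_mul_of_one_le_left hE hM1
  -- combine (everything is linear in `u`, `E`, `(M+1)E`, `Q`, `(M+1)Q`)
  rw [← hSθ, ← hr] at hcirc
  have e1 : (288 : ℝ) * r / (M + 1) = 288 * u := by rw [hu_def]; ring
  have e2 : (290 : ℝ) * r / (M + 1) = 290 * u := by rw [hu_def]; ring
  have e3 : (3 : ℝ) / 2 * (M + 1) * W = 3 * ((M + 1) * E) + 3 * ((M + 1) * Q) := by
    rw [hW_def]; ring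
  rw [e1, e3] at hcirc
  rw [e2]
  rw [abs_le] at hcirc ⊢
  constructor
  · linarith only [hcirc.1, hc1, hc2, hexc, hkey1, hkey2, hEv, hE, hu0]
  · linarith only [hcirc.2, hc1, hc2, hexc, hkey1, hkey2, hEv, hE, hu0]

end IntervalCount

open Literature.NumberTheory.Automorphic
open Literature.NumberTheory.Automorphic.HeckeTraceFormulaGL2Level

/-- **Murty–Sinha Thm. 19 for `S₂(Γ₀(N))` from the trace identities at the powers of `p` ALONE
(no Ramanujan–Petersson / Deligne input).** Let `p ∤ N` be prime, `r = dim S₂(Γ₀(N))`,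
`B(N) = Σ_{c ∣ N} gcd(c, N/c)`, `-2√p ≤ α ≤ β ≤ 2√p`. If `Tr(T_{p^c} | S₂(Γ₀(N))) = A₁ + A₂ + A₃ + A₄`
(`cuspidalHeckeTrace N 2 1 (p^c) = geometricSide N 1 2 (p^c)`) for all `c ≥ 0`, then for every
`M ≥ 0` the number of eigenvalues of `T_p` in `[α, β]` (algebraic multiplicities, as in the vendored
statement) differs from `r ∫_α^β dμ_p` by at most `290 r/(M+1) + 73620 (M+1) p^{12(2M+3)} (B(N)+1)`;
moreover `|r - ψ(N)/12| ≤ 7361(B(N)+1)` (Thm. 13), the count is `≤ r` and `0 ≤ ∫_α^β dμ_p ≤ 1`.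
Identical to `count_sub_integral_le_of_primePowTraces` except that the eigenvalues off
`[-2√p, 2√p]` — not excluded here by Deligne's theorem — are clamped to `±2√p` and paid for by
`abs_card_Icc_sub_integral_le_of_moments` (moments up to `2(2M+3)`; the self-adjointness of `T_p`,
`heckeT_selfAdjoint_holds`, still makes the spectrum real). [cite: MurtySinha2009, Thm. 19 p. 701
and §10 pp. 699–701 (variant without the input of §1 p. 681)] -/
theorem count_sub_integral_le_of_primePowTraces_only (N : ℕ) [NeZero N] (p : ℕ) [NeZero p]
    (hp : p.Prime) (hpN : ¬ p ∣ N)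
    (hTF : ∀ c : ℕ, cuspidalHeckeTrace N 2 1 (p ^ c) = geometricSide N 1 2 (p ^ c))
    {α β : ℝ} (hα : -(2 * Real.sqrt p) ≤ α) (hαβ : α ≤ β) (hβ : β ≤ 2 * Real.sqrt p) (M : ℕ) :
    |(∑ᶠ μ : ℝ, (Set.Icc α β).indicator (fun μ =>
        (Module.finrank ℂ (Module.End.maxGenEigenspace (heckeT (Gamma0 N) 2 p) (μ : ℂ)) : ℝ)) μ) -
        (Module.finrank ℂ (CuspForm (Gamma0 N) 2) : ℝ) * ∫ t in α..β, serreDensity p t|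
      ≤ 290 * (Module.finrank ℂ (CuspForm (Gamma0 N) 2) : ℝ) / (M + 1) +
          73620 * (M + 1) * (p : ℝ) ^ (12 * (2 * M + 3)) *
            (∑ c ∈ N.divisors, (Nat.gcd c (N / c) : ℝ) + 1) ∧
      |(Module.finrank ℂ (CuspForm (Gamma0 N) 2) : ℝ) - (dedekindPsi N : ℝ) / 12| ≤
        7361 * (∑ c ∈ N.divisors, (Nat.gcd c (N / c) : ℝ) + 1) ∧
      (∑ᶠ μ : ℝ, (Set.Icc α β).indicator (fun μ =>
        (Module.finrank ℂ (Module.End.maxGenEigenspace (heckeT (Gamma0 N) 2 p) (μ : ℂ)) : ℝ)) μ) ≤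
        Module.finrank ℂ (CuspForm (Gamma0 N) 2) ∧
      (∫ t in α..β, serreDensity p t) ∈ Set.Icc (0 : ℝ) 1 := by
  classical
  haveI : FiniteDimensional ℂ (CuspForm (Gamma0 N) 2) := finiteDimensional_cuspForm_gamma0 N 2
  set T : Module.End ℂ (CuspForm (Gamma0 N) 2) := heckeT (Gamma0 N) 2 p with hT_def
  set r : ℕ := Module.finrank ℂ (CuspForm (Gamma0 N) 2) with hr_def
  set B : ℝ := ∑ c ∈ N.divisors, (Nat.gcd c (N / c) : ℝ) with hB_def
  have hB : 0 ≤ B := Finset.sum_nonneg fun _ _ ↦ by positivity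
  have hN0 : N ≠ 0 := NeZero.ne N
  have hp2 : (2 : ℝ) ≤ p := by exact_mod_cast hp.two_le
  have hp1 : (1 : ℝ) ≤ p := by linarith
  -- `s = √p`, `q = 1/s`
  set s : ℝ := Real.sqrt p with hs_def
  have hs0 : 0 < s := Real.sqrt_pos.mpr (by linarith)
  have hs1 : 1 < s := by
    rw [hs_def, Real.lt_sqrt zero_le_one]
    linarith
  have hsne : s ≠ 0 := hs0.ne'
  have hss : s * s = p := Real.mul_self_sqrt (by linarith)
  have hs2 : s ^ 2 = p := by rw [sq, hss]
  set q : ℝ := s⁻¹ with hq_def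
  have hq0 : 0 ≤ q := inv_nonneg.mpr hs0.le
  have hq1 : q < 1 := inv_lt_one_of_one_lt₀ hs1
  have hqle : q ≤ 1 := hq1.le
  have hqs : q * s = 1 := inv_mul_cancel₀ hs0.ne'
  -- spectral data
  obtain ⟨E, hreal, hbot, hdim, htr⟩ := heckeT_gamma0_spectralData N 2 p hp hpN
  set d : ℂ → ℕ := fun μ ↦ Module.finrank ℂ (Module.End.eigenspace T μ) with hd_def
  set y : ℂ → ℝ := fun μ ↦ μ.re / s with hy_def
  -- the polynomials `Q_m(μ) = s^m X_m(μ.re/s)` satisfy the `T_{p^m}`-recursion on `E`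
  set Q : ℕ → ℂ → ℂ := fun m μ ↦ ((s ^ m * chebX m (y μ) : ℝ) : ℂ) with hQ_def
  have hre : ∀ μ ∈ E, ((μ.re : ℝ) : ℂ) = μ := fun μ hμ ↦ Complex.conj_eq_iff_re.mp (hreal μ hμ)
  have hQ0 : ∀ μ ∈ E, Q 0 μ = 1 := fun μ _ ↦ by simp [hQ_def]
  have hQ1 : ∀ μ ∈ E, Q 1 μ = μ := fun μ hμ ↦ by
    simp only [hQ_def, pow_one, chebX_one, hy_def]
    rw [mul_div_assoc', mul_div_cancel_left₀ _ hsne, hre μ hμ]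
  have hQ2 : ∀ μ ∈ E, ∀ m : ℕ,
      Q (m + 2) μ = μ * Q (m + 1) μ - (p : ℂ) ^ ((2 : ℤ) - 1) * Q m μ := by
    intro μ hμ m
    have hz : (p : ℂ) ^ ((2 : ℤ) - 1) = p := by norm_num
    rw [hz]
    have key : s ^ (m + 2) * chebX (m + 2) (y μ) =
        μ.re * (s ^ (m + 1) * chebX (m + 1) (y μ)) - p * (s ^ m * chebX m (y μ)) := by
      rw [chebX_add_two, ← hs2]
      simp only [hy_def]
      field_simp
      ring
    simp only [hQ_def]
    rw [key]
    push_cast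
    rw [hre μ hμ]
  -- real moments `Sr c = Σ_μ d_μ X_c(y μ)` and the trace identity `Tr(T_{p^c}) = s^c Sr c`
  set Sr : ℕ → ℝ := fun c ↦ ∑ μ ∈ E, (d μ : ℝ) * chebX c (y μ) with hSr_def
  have htrace : ∀ c : ℕ, cuspidalHeckeTrace N 2 1 (p ^ c) = ((s ^ c * Sr c : ℝ) : ℂ) := by
    intro c
    rw [htr Q hQ0 hQ1 hQ2 c]
    simp only [hSr_def, Finset.mul_sum]
    push_cast
    refine Finset.sum_congr rfl fun μ _ ↦ ?_
    simp only [hQ_def, hd_def]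
    push_cast
    ring
  have hrsum : (r : ℝ) = ∑ μ ∈ E, (d μ : ℝ) := by
    have h : ((r : ℝ) : ℂ) = ((∑ μ ∈ E, (d μ : ℝ) : ℝ) : ℂ) := by
      push_cast
      exact_mod_cast hdim
    exact_mod_cast h
  have hSr0 : Sr 0 = r := by
    rw [hrsum, hSr_def]
    simp
  -- the trace formula: `s^c Sr c = A₁(p^c) + A₂ + A₃ + A₄`, with `A₁ = [c even] ψ/12`
  have hgeo : ∀ c : ℕ, ((s ^ c * Sr c : ℝ) : ℂ) -
      (if Even c then ((dedekindPsi N : ℚ) : ℂ) / 12 else 0) =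
      ellipticTerm N 1 2 (p ^ c) + hyperbolicTerm N 1 2 (p ^ c) + parabolicTerm N 1 2 (p ^ c) := by
    intro c
    rw [← htrace c, hTF c, ← identityTerm_one_two_prime_pow N p hp hpN c, geometricSide]
    ring
  -- the error `e(n) = 7360 n^6 B + n^2 B + n^2` of the three remaining terms
  have herr : ∀ c : ℕ, ‖ellipticTerm N 1 2 (p ^ c) + hyperbolicTerm N 1 2 (p ^ c) +
      parabolicTerm N 1 2 (p ^ c)‖ ≤
      7360 * ((p : ℝ) ^ c) ^ 6 * B + ((p : ℝ) ^ c) ^ 2 * B + ((p : ℝ) ^ c) ^ 2 := by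
    intro c
    have hn1 : 1 ≤ p ^ c := Nat.one_le_pow c p hp.pos
    have h1 := norm_ellipticTerm_one_two_le N (p ^ c) hn1
    have h2 := norm_hyperbolicTerm_one_two_le N (p ^ c)
    have h3 := norm_parabolicTerm_le N 1 2 (p ^ c)
    rw [← hB_def] at h1 h2
    push_cast at h1 h2 h3
    calc _ ≤ ‖ellipticTerm N 1 2 (p ^ c) + hyperbolicTerm N 1 2 (p ^ c)‖ +
          ‖parabolicTerm N 1 2 (p ^ c)‖ := norm_add_le _ _
      _ ≤ ‖ellipticTerm N 1 2 (p ^ c)‖ + ‖hyperbolicTerm N 1 2 (p ^ c)‖ +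
          ‖parabolicTerm N 1 2 (p ^ c)‖ := add_le_add (norm_add_le _ _) le_rfl
      _ ≤ _ := by linarith
  -- consequence 1 (Thm. 13): `|r - ψ/12| ≤ 7361 B + 1 ≤ 7361 (B + 1)`
  have hdimψ' : |(r : ℝ) - (dedekindPsi N : ℝ) / 12| ≤ 7361 * B + 1 := by
    have h := hgeo 0
    simp only [pow_zero, one_mul, Even.zero, if_true, hSr0] at h
    have h' : (((r : ℝ) - (dedekindPsi N : ℝ) / 12 : ℝ) : ℂ) =
        ellipticTerm N 1 2 1 + hyperbolicTerm N 1 2 1 + parabolicTerm N 1 2 1 := by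
      rw [← h]
      push_cast
      ring
    have hn := herr 0
    simp only [pow_zero, one_pow, mul_one, one_mul] at hn
    rw [← h', Complex.norm_real, Real.norm_eq_abs] at hn
    linarith
  have hdimψ : |(r : ℝ) - (dedekindPsi N : ℝ) / 12| ≤ 7361 * (B + 1) := by linarith [hdimψ']
  -- consequence 2: the moment bounds `|Sr c - r γ_c| ≤ E_M` for `c ≤ 2M`
  set γ : ℕ → ℝ := fun c ↦ if Even c then q ^ c else 0 with hγ_def
  have hγ : ∀ c, |γ c| ≤ q ^ c := fun c ↦ by
    simp only [hγ_def]
    split_ifs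
    · rw [abs_of_nonneg (pow_nonneg hq0 c)]
    · rw [abs_zero]
      exact pow_nonneg hq0 c
  set n : ℕ := 2 * M + 3 with hn_def
  set EM : ℝ := 14724 * (p : ℝ) ^ (12 * n) * (B + 1) with hEM_def
  have hmom : ∀ c ≤ 2 * n, |Sr c - r * γ c| ≤ EM := by
    intro c hc
    -- `|s^c Sr c - [c even] ψ/12| ≤ e(p^c)` and `|r - ψ/12| ≤ e(1)`
    have hA : |s ^ c * Sr c - (if Even c then (dedekindPsi N : ℝ) / 12 else 0)| ≤
        7360 * ((p : ℝ) ^ c) ^ 6 * B + ((p : ℝ) ^ c) ^ 2 * B + ((p : ℝ) ^ c) ^ 2 := by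
      have h := hgeo c
      have hcast : ((s ^ c * Sr c - (if Even c then (dedekindPsi N : ℝ) / 12 else 0) : ℝ) : ℂ) =
          ((s ^ c * Sr c : ℝ) : ℂ) - (if Even c then ((dedekindPsi N : ℚ) : ℂ) / 12 else 0) := by
        split_ifs <;> push_cast <;> ring
      have hn := herr c
      rw [← h, ← hcast, Complex.norm_real, Real.norm_eq_abs] at hn
      exact hn
    have hR : |(r : ℝ) - (dedekindPsi N : ℝ) / 12| ≤ 7361 * B + 1 := hdimψ'
    -- combine: `Sr c - r γ_c = q^c ((s^c Sr c - [even] ψ/12) - [even] (r - ψ/12))`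
    have hqc : q ^ c * s ^ c = 1 := by rw [← mul_pow, hqs, one_pow]
    have hqc1 : q ^ c ≤ 1 := pow_le_one₀ hq0 hqle
    have hqc0 : 0 ≤ q ^ c := pow_nonneg hq0 c
    have hkey : Sr c - r * γ c = q ^ c * ((s ^ c * Sr c -
        (if Even c then (dedekindPsi N : ℝ) / 12 else 0)) -
        (if Even c then ((r : ℝ) - (dedekindPsi N : ℝ) / 12) else 0)) := by
      simp only [hγ_def]
      split_ifs <;> linear_combination (-(Sr c)) * hqc
    rw [hkey, abs_mul, abs_of_nonneg hqc0]
    have hsecond : |(if Even c then ((r : ℝ) - (dedekindPsi N : ℝ) / 12) else 0)| ≤ 7361 * B + 1 := by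
      split_ifs
      · exact hR
      · rw [abs_zero]; positivity
    have hpc : ((p : ℝ) ^ c) ^ 6 ≤ (p : ℝ) ^ (12 * n) := by
      rw [← pow_mul]
      exact pow_le_pow_right₀ hp1 (by omega)
    have hpc2 : ((p : ℝ) ^ c) ^ 2 ≤ (p : ℝ) ^ (12 * n) := by
      rw [← pow_mul]
      exact pow_le_pow_right₀ hp1 (by omega)
    have hpM1 : (1 : ℝ) ≤ (p : ℝ) ^ (12 * n) := one_le_pow₀ hp1
    calc q ^ c * |(s ^ c * Sr c - (if Even c then (dedekindPsi N : ℝ) / 12 else 0)) -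
          (if Even c then ((r : ℝ) - (dedekindPsi N : ℝ) / 12) else 0)|
        ≤ 1 * ((7360 * ((p : ℝ) ^ c) ^ 6 * B + ((p : ℝ) ^ c) ^ 2 * B + ((p : ℝ) ^ c) ^ 2) +
            (7361 * B + 1)) := by
          refine mul_le_mul hqc1 ((abs_sub _ _).trans (add_le_add hA hsecond)) (abs_nonneg _)
            zero_le_one
      _ ≤ EM := by
          rw [one_mul, hEM_def]
          nlinarith [mul_le_mul_of_nonneg_right hpc hB, mul_le_mul_of_nonneg_right hpc2 hB,
            mul_le_mul_of_nonneg_right hpM1 hB, hpM1, hpc2, hB]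
  -- the eigenvalue family indexed by `ι = Σ_{μ ∈ E} Fin d_μ`
  have hrsumN : r = ∑ μ ∈ E, d μ := by exact_mod_cast hrsum
  let ι : Type := (μ : E) × Fin (d μ)
  set x : ι → ℝ := fun i ↦ y i.1 with hx_def
  have hcardι : Fintype.card ι = r := by
    rw [hrsumN, Fintype.card_sigma]
    simp only [Fintype.card_fin]
    exact Finset.sum_coe_sort E d
  have hsumι : ∀ c : ℕ, ∑ i : ι, chebX c (x i) = Sr c := by
    intro c
    show ∑ i : ι, chebX c (x i) = ∑ μ ∈ E, (d μ : ℝ) * chebX c (y μ)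
    rw [← Finset.sum_coe_sort E (fun μ ↦ (d μ : ℝ) * chebX c (y μ)),
      ← Finset.univ_sigma_univ, Finset.sum_sigma]
    refine Finset.sum_congr rfl fun μ _ ↦ ?_
    simp [hx_def, Finset.sum_const, Finset.card_univ, Fintype.card_fin, nsmul_eq_mul]
  -- (1)+(2) the interval count from the Chebyshev moments (no a-priori bound on the `x_i`)
  have hEM0 : 0 ≤ EM := by rw [hEM_def]; positivity
  have ha : -2 ≤ α / s := by rw [le_div_iff₀ hs0]; linarith
  have hb : β / s ≤ 2 := by rw [div_le_iff₀ hs0]; linarith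
  have hab : α / s ≤ β / s := div_le_div_of_nonneg_right hαβ hs0.le
  have hmom' : ∀ c : ℕ, c ≤ 2 * (2 * M + 3) →
      |∑ i : ι, chebX c (x i) -
        Fintype.card ι * (if Even c then (Real.sqrt (p : ℝ))⁻¹ ^ c else 0)| ≤ EM := by
    intro c hc
    have h := hmom c (by omega)
    rw [← hsumι c] at h
    rw [hcardι]
    have hg : (if Even c then (Real.sqrt (p : ℝ))⁻¹ ^ c else 0) = γ c := by
      simp only [hγ_def, hq_def, hs_def]
    rw [hg]
    exact h
  have hB2 := abs_card_Icc_sub_integral_le_of_moments x (p := (p : ℝ)) hp2 (M := M) hEM0 hmom'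
    ha hab hb
  rw [hcardι] at hB2
  -- (3) the count of the statement is the count of the family
  have hgen : ∀ z, T.maxGenEigenspace z = T.eigenspace z := fun z ↦
    maxGenEigenspace_eq_eigenspace_of_selfAdjoint
      (fun x y ↦ peterssonProduct (Gamma0 N) 2 x y)
      (fun u v w ↦ peterssonProduct_add_right 2 u v w)
      (fun c v w ↦ peterssonProduct_smul_right (Gamma0 N) 2 c v w)
      (fun v w ↦ peterssonProduct_conj_symm_holds (Gamma0 N) 2 v w)
      (fun v hv ↦ eq_zero_of_peterssonProduct_self_eq_zero 2 v hv)
      T (fun v w ↦ heckeT_selfAdjoint_holds N 2 p hp hpN v w) z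
  have hcount : (∑ᶠ μ : ℝ, (Set.Icc α β).indicator (fun μ =>
      (Module.finrank ℂ (Module.End.maxGenEigenspace T (μ : ℂ)) : ℝ)) μ) =
      ((Finset.univ.filter fun i : ι => x i ∈ Set.Icc (α / s) (β / s)).card : ℝ) := by
    have hcount0 : (∑ᶠ μ : ℝ, (Set.Icc α β).indicator (fun μ =>
        (Module.finrank ℂ (Module.End.maxGenEigenspace T (μ : ℂ)) : ℝ)) μ) =
        ∑ᶠ μ : ℝ, (Set.Icc α β).indicator (fun μ =>
          (Module.finrank ℂ (Module.End.eigenspace T (μ : ℂ)) : ℝ)) μ := by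
      congr 1
      funext μ
      congr 1
      funext ν
      rw [hgen]
    rw [hcount0]
    -- finsum over the reals = sum over the real parts of `E`
    have hinj : Set.InjOn ((↑) : ℝ → ℂ) (((↑) : ℝ → ℂ) ⁻¹' (E : Set ℂ)) :=
      Complex.ofReal_injective.injOn
    set S : Finset ℝ := E.preimage ((↑) : ℝ → ℂ) hinj with hS
    have hsupp : Function.support (fun μ : ℝ => (Set.Icc α β).indicator
        (fun μ => (Module.finrank ℂ (Module.End.eigenspace T (μ : ℂ)) : ℝ)) μ) ⊆ (S : Set ℝ) := by
      intro μ hμ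
      rw [Function.mem_support] at hμ
      rw [hS, Finset.coe_preimage, Set.mem_preimage, Finset.mem_coe]
      by_contra hE
      apply hμ
      rw [Set.indicator_apply_eq_zero]
      intro _
      have := hbot _ hE
      change (d (μ : ℂ) : ℝ) = 0
      simp only [hd_def]
      rw [this, finrank_bot, Nat.cast_zero]
    rw [finsum_eq_sum_of_support_subset _ hsupp]
    have hpre := Finset.sum_preimage ((↑) : ℝ → ℂ) E hinj
      (fun μ : ℂ => if μ.re ∈ Set.Icc α β then (d μ : ℝ) else 0) (by
        intro μ hμ hrange
        exfalso
        exact hrange ⟨μ.re, hre μ hμ⟩)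
    have e1 : ∀ ν ∈ S, (Set.Icc α β).indicator
        (fun μ : ℝ => (Module.finrank ℂ (Module.End.eigenspace T (μ : ℂ)) : ℝ)) ν =
        (fun μ : ℂ => if μ.re ∈ Set.Icc α β then (d μ : ℝ) else 0) (ν : ℂ) := by
      intro ν _
      first
        | rfl
        | simp [Set.indicator_apply, hd_def]
    rw [Finset.sum_congr rfl e1, hpre]
    -- the family count
    have hfam : ((Finset.univ.filter fun i : ι => x i ∈ Set.Icc (α / s) (β / s)).card : ℝ) =
        ∑ i : ι, if x i ∈ Set.Icc (α / s) (β / s) then (1 : ℝ) else 0 := by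
      rw [Finset.sum_boole]
    rw [hfam, ← Finset.sum_coe_sort E, ← Finset.univ_sigma_univ, Finset.sum_sigma]
    refine Finset.sum_congr rfl fun μ _ ↦ ?_
    have hiff : y (μ : ℂ) ∈ Set.Icc (α / s) (β / s) ↔ (μ : ℂ).re ∈ Set.Icc α β := by
      simp only [hy_def, Set.mem_Icc]
      rw [div_le_div_iff_of_pos_right hs0, div_le_div_iff_of_pos_right hs0]
    simp only [hx_def, Finset.sum_const, Finset.card_univ, Fintype.card_fin, nsmul_eq_mul]
    split_ifs with h1 h2 h2
    · ring
    · exact absurd (hiff.mpr h1) h2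
    · exact absurd (hiff.mp h2) h1
    · ring
  -- (4) the integral of the statement is the integral of `2 g_p` over the angles
  have hαmem : α ∈ Set.Icc (-(2 * Real.sqrt p)) (2 * Real.sqrt p) := ⟨hα, by linarith⟩
  have hβmem : β ∈ Set.Icc (-(2 * Real.sqrt p)) (2 * Real.sqrt p) := ⟨by linarith, hβ⟩
  have hp1' : (1 : ℝ) < p := by linarith
  have hint : ∫ t in α..β, serreDensity p t =
      ∫ θ in Real.arccos (β / s / 2)..Real.arccos (α / s / 2), 2 * kmDensity p θ := by
    rw [integral_serreDensity_eq hp1' hαmem hβmem, div_div, div_div, mul_comm s 2]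
  refine ⟨?_, hdimψ, ?_, ?_⟩
  · rw [hcount, hint]
    calc _ ≤ 290 * (r : ℝ) / (M + 1) + 5 * (M + 1) * EM := hB2
      _ = _ := by rw [hEM_def, hn_def]; ring
  · rw [hcount, ← hcardι]
    exact_mod_cast Finset.card_filter_le _ _
  · rw [hint]
    have h1 : -1 ≤ β / s / 2 ∧ β / s / 2 ≤ 1 := by
      rw [div_div, le_div_iff₀ (by positivity), div_le_iff₀ (by positivity)]; constructor <;> linarith
    have h2 : -1 ≤ α / s / 2 ∧ α / s / 2 ≤ 1 := by
      rw [div_div, le_div_iff₀ (by positivity), div_le_iff₀ (by positivity)]; constructor <;> linarith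
    exact integral_two_mul_kmDensity_mem hp1' (Real.arccos_nonneg _)
      (Real.arccos_le_arccos (by rw [div_div, div_div]; exact div_le_div_of_nonneg_right hαβ (by positivity)))
      (Real.arccos_le_pi _)

end MurtySinha

open Literature.NumberTheory.Automorphic
  Literature.NumberTheory.Automorphic.HeckeTraceFormulaGL2Level in
/-- **Murty–Sinha 2009, Theorem 2 (weight `2`), from the trace identities at prime powers ALONE.**
If for every level `N ≥ 1` and prime `p ∤ N` the Eichler–Selberg identity
`Tr(T_{p^c} | S₂(Γ₀(N))) = A₁ + A₂ + A₃ + A₄` (Schoof–van der Vlugt Thm. 2.2 = Murty–Sinha Thm. 10,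
weight `2`, trivial character, `n = p^c`) holds for all `c ≥ 0`, then the named fact
`murtySinha2009_thm2_weightTwo` holds — Deligne's theorem (the second input of
`murtySinha2009_thm2_weightTwo_of_primePowTraces`, loc. cit. §1 p. 681) is NOT needed: the
eigenvalues off `[-2√p, 2√p]` are controlled by the trace formula itself
(`MurtySinha.count_sub_integral_le_of_primePowTraces_only`), and the bookkeeping
`MurtySinha.real_bookkeeping` is applied to `(37/1160)·|count - r∫dμ_p| ≤ r` at the shifted
parameter `M' = ⌊(M-3)/2⌋`. The absolute constant is `A = (1160/37)·A₂₃`, `A₂₃` the constant of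
`multiplicity_bookkeeping`. [cite: MurtySinha2009, Thm. 2 p. 682 and §10 p. 701 (variant)] -/
theorem murtySinha2009_thm2_weightTwo_of_primePowTraces_only
    (hTF : ∀ (N : ℕ) [NeZero N] (p : ℕ) [NeZero p], p.Prime → ¬ p ∣ N →
      ∀ c : ℕ, cuspidalHeckeTrace N 2 1 (p ^ c) = geometricSide N 1 2 (p ^ c)) :
    murtySinha2009_thm2_weightTwo := by
  unfold murtySinha2009_thm2_weightTwo
  refine ⟨1160 / 37 * (7401 + (75 / 2 * Real.log (101 * (58896 * 82) * 4800 / Real.log 2) +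
      (Real.log 2 + 6 * Real.log (24 * 7361 * 82))) / Real.log 2), ?_⟩
  intro N _ p _ hp hpN α β hα hαβ hβ
  have hN0 : N ≠ 0 := NeZero.ne N
  set r : ℕ := Module.finrank ℂ (CuspForm (Gamma0 N) 2) with hr
  set Q : ℝ := |(∑ᶠ μ : ℝ, (Set.Icc α β).indicator (fun μ =>
      (Module.finrank ℂ (Module.End.maxGenEigenspace (heckeT (Gamma0 N) 2 p) (μ : ℂ)) : ℝ)) μ) -
      (r : ℝ) * ∫ t in α..β, ((p : ℝ) + 1) * Real.sqrt (4 * p - t ^ 2) /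
        (2 * Real.pi * (((p : ℝ) + 1) ^ 2 - t ^ 2))| with hQ
  have hres := fun M : ℕ ↦ MurtySinha.count_sub_integral_le_of_primePowTraces_only N p hp hpN
    (hTF N p hp hpN) hα hαβ hβ M
  have hser : (fun t : ℝ => ((p : ℝ) + 1) * Real.sqrt (4 * p - t ^ 2) /
      (2 * Real.pi * (((p : ℝ) + 1) ^ 2 - t ^ 2))) = MurtySinha.serreDensity (p : ℝ) := by
    funext t; rfl
  have hQ' : Q = |(∑ᶠ μ : ℝ, (Set.Icc α β).indicator (fun μ =>
      (Module.finrank ℂ (Module.End.maxGenEigenspace (heckeT (Gamma0 N) 2 p) (μ : ℂ)) : ℝ)) μ) -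
      (r : ℝ) * ∫ t in α..β, MurtySinha.serreDensity p t| := by
    rw [hQ, ← hser]
  have hQ0 : 0 ≤ Q := by rw [hQ]; exact abs_nonneg _
  -- the rescaled quantity `m = (37/1160) Q`
  set m : ℝ := 37 / 1160 * Q with hm
  have hB : (0 : ℝ) ≤ ∑ c ∈ N.divisors, (Nat.gcd c (N / c) : ℝ) :=
    Finset.sum_nonneg fun _ _ ↦ by positivity
  set B : ℝ := ∑ c ∈ N.divisors, (Nat.gcd c (N / c) : ℝ) with hB_def
  have hp2 : (2 : ℝ) ≤ p := by exact_mod_cast hp.two_le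
  have hp1 : (1 : ℝ) ≤ p := by linarith
  have hdim := (hres 0).2.1
  have hr0 : (0 : ℝ) ≤ r := by positivity
  -- the trivial bound `Q ≤ 2r`, hence `m ≤ r`
  have hQle : Q ≤ 2 * r := by
    have h3 := (hres 0).2.2.1
    have h4 := (hres 0).2.2.2
    have hcnt0 : 0 ≤ ∑ᶠ μ : ℝ, (Set.Icc α β).indicator (fun μ =>
        (Module.finrank ℂ (Module.End.maxGenEigenspace (heckeT (Gamma0 N) 2 p) (μ : ℂ)) : ℝ)) μ :=
      finsum_nonneg fun μ ↦ Set.indicator_nonneg (fun _ _ ↦ by positivity) _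
    rw [hQ', abs_le]
    constructor <;> nlinarith [h4.1, h4.2, h3, hcnt0]
  have hmr : m ≤ r := by rw [hm]; linarith
  -- the core bound for all `M`, from the bound at `M' = ⌊(M-3)/2⌋`
  have hcore : ∀ M : ℕ, m ≤ 74 * (r : ℝ) / (M + 1) +
      58896 * (M + 1) * (p : ℝ) ^ (12 * M) * (B + 1) := by
    intro M
    have hM0 : (0 : ℝ) < M + 1 := by positivity
    have htail : 0 ≤ 58896 * ((M : ℝ) + 1) * (p : ℝ) ^ (12 * M) * (B + 1) := by positivity
    rcases lt_or_ge M 3 with hM3 | hM3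
    · -- `M ≤ 2`: `m ≤ r ≤ 74 r/(M+1)`
      have hM3' : (M : ℝ) + 1 ≤ 3 := by exact_mod_cast (show M + 1 ≤ 3 by omega)
      have h1 : (r : ℝ) ≤ 74 * r / (M + 1) := by
        rw [le_div_iff₀ hM0]
        nlinarith [mul_le_mul_of_nonneg_left hM3' hr0]
      linarith
    · set M' : ℕ := (M - 3) / 2 with hM'
      have h := (hres M').1
      rw [← hQ'] at h
      have e1 : (290 : ℝ) * (Module.finrank ℂ (CuspForm (Gamma0 N) 2) : ℝ) / (M' + 1) =
          290 * (r : ℝ) / (M' + 1) := by rw [hr]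
      rw [e1] at h
      have hM'1 : (M' : ℝ) + 1 ≤ M + 1 := by
        exact_mod_cast (show M' + 1 ≤ M + 1 by omega)
      have hM'8 : (M : ℝ) + 1 ≤ 8 * ((M' : ℝ) + 1) := by
        exact_mod_cast (show M + 1 ≤ 8 * (M' + 1) by omega)
      have hM'0 : (0 : ℝ) < (M' : ℝ) + 1 := by positivity
      have hpow : (p : ℝ) ^ (12 * (2 * M' + 3)) ≤ (p : ℝ) ^ (12 * M) :=
        pow_le_pow_right₀ hp1 (by omega)
      have hfirst : 290 * (r : ℝ) / (M' + 1) ≤ 2320 * r / (M + 1) := by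
        rw [div_le_div_iff₀ hM'0 hM0]
        nlinarith [mul_nonneg hr0 (sub_nonneg.mpr hM'8)]
      have hsecond : 73620 * ((M' : ℝ) + 1) * (p : ℝ) ^ (12 * (2 * M' + 3)) * (B + 1) ≤
          73620 * ((M : ℝ) + 1) * (p : ℝ) ^ (12 * M) * (B + 1) := by
        have hB1 : 0 ≤ B + 1 := by linarith
        have hp0 : 0 ≤ (p : ℝ) ^ (12 * (2 * M' + 3)) := by positivity
        apply mul_le_mul_of_nonneg_right _ hB1
        exact mul_le_mul (by linarith) hpow hp0 (by positivity)
      rw [hm]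
      have hQ2 : Q ≤ 2320 * (r : ℝ) / (M + 1) +
          73620 * ((M : ℝ) + 1) * (p : ℝ) ^ (12 * M) * (B + 1) := by
        linarith
      have e2 : (2320 : ℝ) * r / (M + 1) = 2320 * ((r : ℝ) / (M + 1)) := by ring
      have e3 : (74 : ℝ) * r / (M + 1) = 74 * ((r : ℝ) / (M + 1)) := by ring
      rw [e2] at hQ2
      rw [e3]
      have hX : 0 ≤ ((M : ℝ) + 1) * (p : ℝ) ^ (12 * M) * (B + 1) := by positivity
      nlinarith [hQ2, hX]
  have hBle := MurtySinha.sum_divisors_gcd_le_rpow N hN0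
  have hψ : (N : ℝ) ≤ (dedekindPsi N : ℝ) := by exact_mod_cast MurtySinha.le_dedekindPsi N
  have hbk := MurtySinha.real_bookkeeping N p r m hN0 hp.two_le _ _ hmr hB hBle hψ hdim hcore
  rw [hm] at hbk
  have hfin : Q ≤ 1160 / 37 * ((7401 + (75 / 2 * Real.log (101 * (58896 * 82) * 4800 / Real.log 2) +
      (Real.log 2 + 6 * Real.log (24 * 7361 * 82))) / Real.log 2) * r * Real.log p /
      Real.log (2 * N)) := by
    linarith
  rw [hQ] at hfin
  convert hfin using 1
  ring

open Literature.NumberTheory.Automorphic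
  Literature.NumberTheory.Automorphic.HeckeTraceFormulaGL2Level in
/-- **Murty–Sinha 2009, Theorem 2 (weight `2`), from the Eichler–Selberg trace formula alone.** If
the trace formula `HeckeTraceFormulaGL2Level N 1 2` (Schoof–van der Vlugt Thm. 2.2 = Murty–Sinha
Thm. 10) holds at every level `N`, then `murtySinha2009_thm2_weightTwo` holds. Compared with
`murtySinha2009_thm2_weightTwo_of_traceFormula` the hypothesis
`Deligne1974_heckeT_eigenvalue_norm_le` is gone: of the two external inputs of the printed proof
only the trace formula remains. [cite: MurtySinha2009, Thm. 2 p. 682 (variant of the proof,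
pp. 684–701, without §1's appeal to Deligne)] -/
theorem murtySinha2009_thm2_weightTwo_of_traceFormula_only
    (hTF : ∀ (N : ℕ) [NeZero N], HeckeTraceFormulaGL2Level N 1 2) :
    murtySinha2009_thm2_weightTwo :=
  murtySinha2009_thm2_weightTwo_of_primePowTraces_only (fun N _ _ _ hp _ c ↦
    MurtySinha.traceFormula_two_one (hTF N) (pow_pos hp.pos c))

end Literature.NumberTheory.EllipticCurves.ModularForms

end
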